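import Summits.QuantumFields.YangMills.Theorems.BalabanUVNodesN08AlphaInB42Sel
import Summits.QuantumFields.YangMills.Theorems.BalabanUVNodesN08AlphaThreeFaces

/-!
# Route «BalabanUVNodes», Track-A DAG node N08 = [Balaban1985UV3] — THE (α) CLAUSE AND N08 AT THE RECORD FOR MINIMISER-SELECTED EXTERNAL INPUTS:
# `RunAlpha` ∕ `Dag.B10_main` from the DATA schema and the two in-edge conclusions (b7) ∕ (b11), the in-edge FACES discharged

Cell `pub-ymgap`, seat `pub-ymgap-dag-n08-d` gen 4, file 4 (director-ym R134 row «CLASS-I in-edge conclusions at the (α) granularity of `RunAlpha` …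
discharge the species-OK interfaces `h68 ∕ hU ∕ h44 ∕ hLF67`»).  `bears_on: R4∕N08`; filed `--supports stmt-QuantumFields-19903 --as helper`.  Sorry-free,
standard axioms.  COMPOSITION of this seat's file 3 (`BalabanUVNodesN08AlphaInB42Sel.exists_externalInputs_faces₃`: external inputs EXIST — same
averaging ∕ regular classes as any given `X₀` — whose `U_k(·, h)` are measurable (42)-minimiser selections satisfying the three-face schema
`InEdgeFaces₃` from (b7) continuity of the lift averages on [7]'s class + (b11) solvability of (42) in the class) with gen 3's
`BalabanUVNodesN08AlphaThreeFaces` (`RunAlpha` and N08 at the C-binding from «DATA schema ∧ `InEdgeFaces₃` at `regMin 𝔠`» on the N08 family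
`g²ε₀ ≤ (min γ_N08 1)²`).

WHAT THIS FILE PROVES.
* §1 ★ `exists_externalInputs_runAlpha`: per lattice approximation `S`, from `X₀`, a continuous objective, `h`-large lift data, open small-field sets, top maps ∕
  bonds, and the displayed in-edge conclusions (b7) `hcont`∕`hT`, (b11) `hsolv` (at print's single regularity constant, `regMin 𝔠`): THERE ARE external
  inputs `X` (`X.av = X₀.av`, `X.reg = X₀.reg`, every `X.UkH k h` measurable, `InEdgeFaces₃ 𝔊 (regMin 𝔠) X`) such that FOR EVERY expansion data
  `𝔖`, auxiliary data `𝔄` and coefficient sizes: the DATA schema `RunDataRows` on the N08 family gives `RunAlpha 𝔊 𝔠 X 𝔖 𝔄` — the lane's (α) clause.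
* §2 ★ `exists_externalInputs_b10_main_family`: the same uniformly in `S` (a family `X S`), and N08 BY NAME: for every `𝔖, 𝔄, coef` with the DATA schema
  on the family and every C-binding world whose upstream is bound over the constructed towers `towerOf 𝔠.lane (X S) (𝔖 S)`, `Dag.B10_main (leavesP w P)`
  (gen 3's `b10_main_constructedLE_upC_of_faces₃_family` with its face hypothesis DISCHARGED by the selection).
So after gen 4 the (α) clause of record reads: DATA schema (class II object gap + class III + pin-shapes + b9 faces, gen 3) ∧ (b7) ∧ (b11) — the four
in-edge FACES about `X.UkH` (`measUk`, `loop28`, `inB42`, `reg2`) of gen 0 are no longer hypotheses for these external inputs.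
HONEST FRAMING.  (b7), (b11) and the DATA schema are DISPLAYED; the external inputs are EXISTENTIAL (a measurable selection, not print's analytic
`U_k(V)`); nothing of [B10] ∕ [7] ∕ [4] is asserted; count-neutral; NOT a discharge of N08.  d = 3 lattice gauge theory on finite tori as printed;
nothing about d = 4, the continuum, OS axioms, a mass gap or the Clay problem.
-/

noncomputable section

namespace Summit.QuantumFields.YangMills.Theorems.BalabanUVNodesN08AlphaSelEnd

open MeasureTheory Set Topology TopologicalSpace
open scoped Matrix Matrix.Norms.L2Operator
open Literature.MeasureTheory.RandomSets
open Literature.MathematicalPhysics.QuantumFieldTheory.Balaban1983to89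
open Literature.MathematicalPhysics.QuantumFieldTheory.Balaban1983to89.B10 (pFun)
open Literature.MathematicalPhysics.QuantumFieldTheory.Balaban1983to89.B10SectCExpansion (TermSizes)
open Literature.MathematicalPhysics.QuantumFieldTheory.Balaban1985CMP102
open Literature.MathematicalPhysics.QuantumFieldTheory.Balaban1985CMP102.Setting
open Literature.MathematicalPhysics.QuantumFieldTheory.Balaban1983to89.DagBinding (leavesP WorldP PrintedCarriersR PrintedCarriers9X
  PrintedCarriers11 PrintedCarriers14R PrintedCarriers15)
open Literature.MathematicalPhysics.QuantumFieldTheory.Balaban1983to89.B10CompactBinding (ofPrintedAllXPNC)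
open Summit.QuantumFields.Balaban3D.Carriers
open Summit.QuantumFields.Balaban3D.Proofs.Inputs
open Summit.QuantumFields.Balaban3D.Proofs.Primitives (AlphaConsts)
open Summit.QuantumFields.Balaban3D.Proofs.GroupModelLieC (lieC)
open Summit.QuantumFields.Balaban3D.Proofs.UVStability3DInputs
open Summit.QuantumFields.Balaban3D.Proofs.FamilyLE (ScalesLE)
open Summit.QuantumFields.Balaban3D.Proofs.LiftBridge (liftCfg)
open Summit.QuantumFields.Balaban3D.Proofs.TorusLift (projSite)
open Summit.QuantumFields.YangMills.Theorems.BalabanUVNodesN08AlphaClassI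
open Summit.QuantumFields.YangMills.Theorems.BalabanUVNodesN08AlphaLoop28
open Summit.QuantumFields.YangMills.Theorems.BalabanUVNodesN08AlphaThreeFaces (regMin gammaN08 runAlpha_of_data_faces₃_of_le
  b10_main_constructedLE_upC_of_faces₃_family)
open Summit.QuantumFields.YangMills.Theorems.BalabanUVNodesN08AlphaGroupTopology
open Summit.QuantumFields.YangMills.Theorems.BalabanUVNodesN08AlphaRegSel
open Summit.QuantumFields.YangMills.Theorems.BalabanUVNodesN08AlphaInB42Sel
open B7Prop1Explicit (e)
open B7Prop2Explicit (avgIter)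

variable {L : ℕ}

/-! ## §1 The (α) clause for minimiser-selected external inputs, per lattice approximation -/

section Alpha

variable {S : Scales L} {G : Type} [GaugeGroup G] [MeasurableSpace G] [HaarData G] (𝔊 : GroupModel G) (𝔠 : AlphaConsts L 𝔊.N)

/-- **★ THE (α) CLAUSE FOR EXTERNAL INPUTS THAT EXIST.**  Data: `X₀` (averaging ∕ regular classes), a continuous objective `A`, `h`-large lift data
`Vl k h`, open small-field sets `Sm k h`, top maps `T k` and bonds `Bk k h`; DISPLAYED: (b7) `hcont`∕`hT` (continuity of the lift `j`-fold averages at the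
bonds of `Λ_j(h)` and of `T k` on [7]'s class at print's single regularity constant `regMin 𝔠`, in `rhoTopology 𝔊`), (b11) `hsolv` (for `k ≤ K`,
admissible `h`, every `V`, (42) has a minimiser of `A` in the class).  THEN there are external inputs `X` — `X.av = X₀.av`, `X.reg = X₀.reg`, every
`X.UkH k h` measurable, `InEdgeFaces₃ 𝔊 (regMin 𝔠) X` — such that for EVERY expansion data `𝔖`, auxiliary data `𝔄` and coefficient sizes `coef`,
the DATA schema at the concrete sizes on the N08 family `g²ε₀ ≤ (min γ_N08 1)²` yields the lane's (α) clause `RunAlpha 𝔊 𝔠 X 𝔖 𝔄`.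
[cite: Balaban1985UV3, (41)–(42) p.266 + (44) p.267 + (67)–(68) p.273; Balaban1985Variational, (2)+(3)+(8) pp.278–279; Balaban1985Averaging, (42)–(43) pp.23–24] -/
theorem exists_externalInputs_runAlpha (X₀ : ExternalInputs S G) {A : GaugeField S.P 0 G → ℝ} (hA : letI := rhoTopology 𝔊; Continuous A)
    (Vl : (k : ℕ) → Hist S.P k → ℕ → B7Prop1Explicit.Site S.P.d → Fin S.P.d → (Matrix (Fin 𝔊.N) (Fin 𝔊.N) ℂ)ˣ)
    (hVl : ∀ (k : ℕ) (h : Hist S.P k), HLarge S (regMin 𝔠).lane.carrier.b₀ (regMin 𝔠).lane.carrier.p₀ h (Vl k h))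
    (Sm : (k : ℕ) → Hist S.P k → Set (GaugeField S.P k G)) (hSm : letI := rhoTopology 𝔊; ∀ k h, IsOpen (Sm k h))
    (T : (k : ℕ) → GaugeField S.P 0 G → GaugeField S.P k G) (Bk : (k : ℕ) → Hist S.P k → Set (PBond S.P k))
    (hcont : letI := rhoTopology 𝔊; ∀ (k : ℕ) (h : Hist S.P k), ∀ j < k, ∀ (z : B7Prop1Explicit.Site S.P.d) (κ : Fin S.P.d),
      projSite (((L : ℤ) ^ j) • z) ∈ Lam (regMin 𝔠).lane.carrier.M₁ (rcolOf S (regMin 𝔠).lane.carrier) h j →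
      projSite (((L : ℤ) ^ j) • (z + e κ)) ∈ Lam (regMin 𝔠).lane.carrier.M₁ (rcolOf S (regMin 𝔠).lane.carrier) h j →
      ContinuousOn (fun U : GaugeField S.P 0 G => ((avgIter L (liftCfg 𝔊 U) j z κ : (Matrix (Fin 𝔊.N) (Fin 𝔊.N) ℂ)ˣ) :
        Matrix (Fin 𝔊.N) (Fin 𝔊.N) ℂ)) (regClass 𝔊 (regMin 𝔠) k h))
    (hT : letI := rhoTopology 𝔊; ∀ (k : ℕ) (h : Hist S.P k), ContinuousOn (T k) (regClass 𝔊 (regMin 𝔠) k h))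
    (hsolv : ∀ k, k ≤ S.K → ∀ (h : Hist S.P k), Hist.Admissible (regMin 𝔠).lane.carrier.M₁ (rcolOf S (regMin 𝔠).lane.carrier) k h →
      ∀ (V : GaugeField S.P k G), ∃ U ∈ admB42 𝔊 (regMin 𝔠) k h (Vl k h) (Sm k h) (T k) (Bk k h) V,
        IsMinOn A (admB42 𝔊 (regMin 𝔠) k h (Vl k h) (Sm k h) (T k) (Bk k h) V) U) :
    ∃ X : ExternalInputs S G, X.av = X₀.av ∧ X.reg = X₀.reg ∧ (∀ (k : ℕ) (h : Hist S.P k), Measurable (X.UkH k h)) ∧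
      InEdgeFaces₃ 𝔊 (regMin 𝔠) X ∧
      ∀ (𝔖 : ∀ k, StepSeries S G ↥(lieC 𝔊) (nblkOf S 𝔠.lane.carrier k) k) (𝔄 : AlphaData 𝔊 𝔠 X 𝔖)
        (coef : (k : ℕ) → Hist S.P (k + 1) → GaugeField S.P (k + 1) G → (j : ℕ) → TermSizes (oldGeom S.P k j)),
        S.g ^ 2 * S.ε₀ ≤ (min (gammaN08 𝔠) 1) ^ 2 → RunDataRows 𝔊 𝔠 X 𝔖 𝔄 (sizesOf 𝔊 𝔠 X coef) → RunAlpha 𝔊 𝔠 X 𝔖 𝔄 := by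
  obtain ⟨X, hav, hreg, hm, -, -, -, F⟩ :=
    exists_externalInputs_faces₃ 𝔊 (regMin 𝔠) X₀ hA Vl hVl Sm hSm T Bk hcont hT hsolv
  exact ⟨X, hav, hreg, hm, F, fun 𝔖 𝔄 coef hle D => runAlpha_of_data_faces₃_of_le 𝔊 𝔠 X 𝔖 𝔄 coef hle D F⟩

end Alpha

/-! ## §2 Uniformly in the lattice approximation: a family of external inputs, and N08 by name at the C-binding -/

section Family

variable {G : Type} [GaugeGroup G] [MeasurableSpace G] [HaarData G] (𝔊 : GroupModel G) (𝔠 : AlphaConsts L 𝔊.N)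

/-- **★ N08 BY NAME AT THE C-BINDING OVER THE CONSTRUCTED RUNS OF MINIMISER-SELECTED EXTERNAL INPUTS, FROM THE DATA SCHEMA AND (b7) ∕ (b11).**  Given,
for every lattice approximation `S`, the data of §1 with (b7) ∕ (b11) displayed, there is a FAMILY of external inputs `X S` (same `av`, `reg` as
`X₀ S`; every `U_k(·, h)` measurable; `InEdgeFaces₃ 𝔊 (regMin 𝔠) (X S)`) such that: (i) for every `S`, expansion data, auxiliary data and sizes,
the DATA schema on the N08 family gives `RunAlpha`; (ii) for every `𝔖, 𝔄, coef` with the DATA schema on the family and every C-binding world `(w, P)`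
whose upstream is bound over the printed carriers whose B10 runs are the constructed towers `towerOf 𝔠.lane (X S) (𝔖 S)`, `S ∈ ScalesLE L ((min γ_N08 1)²)`,
the DAG node holds: `Dag.B10_main (leavesP w P)` (gen 3's `b10_main_constructedLE_upC_of_faces₃_family`, its face hypothesis discharged).
[cite: Balaban1985UV3, Thm 1 p.257 (compact reading) + Thm 2 p.272 + (42) p.266; Balaban1985Variational, Thm 1 p.279] -/
theorem exists_externalInputs_b10_main_family (X₀ : ∀ S : Scales L, ExternalInputs S G)
    {A : ∀ S : Scales L, GaugeField S.P 0 G → ℝ} (hA : letI := rhoTopology 𝔊; ∀ S, Continuous (A S))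
    (Vl : ∀ (S : Scales L) (k : ℕ), Hist S.P k → ℕ → B7Prop1Explicit.Site S.P.d → Fin S.P.d → (Matrix (Fin 𝔊.N) (Fin 𝔊.N) ℂ)ˣ)
    (hVl : ∀ (S : Scales L) (k : ℕ) (h : Hist S.P k), HLarge S (regMin 𝔠).lane.carrier.b₀ (regMin 𝔠).lane.carrier.p₀ h (Vl S k h))
    (Sm : ∀ (S : Scales L) (k : ℕ), Hist S.P k → Set (GaugeField S.P k G)) (hSm : letI := rhoTopology 𝔊; ∀ S k h, IsOpen (Sm S k h))
    (T : ∀ (S : Scales L) (k : ℕ), GaugeField S.P 0 G → GaugeField S.P k G) (Bk : ∀ (S : Scales L) (k : ℕ), Hist S.P k → Set (PBond S.P k))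
    (hcont : letI := rhoTopology 𝔊; ∀ (S : Scales L) (k : ℕ) (h : Hist S.P k), ∀ j < k, ∀ (z : B7Prop1Explicit.Site S.P.d) (κ : Fin S.P.d),
      projSite (((L : ℤ) ^ j) • z) ∈ Lam (regMin 𝔠).lane.carrier.M₁ (rcolOf S (regMin 𝔠).lane.carrier) h j →
      projSite (((L : ℤ) ^ j) • (z + e κ)) ∈ Lam (regMin 𝔠).lane.carrier.M₁ (rcolOf S (regMin 𝔠).lane.carrier) h j →
      ContinuousOn (fun U : GaugeField S.P 0 G => ((avgIter L (liftCfg 𝔊 U) j z κ : (Matrix (Fin 𝔊.N) (Fin 𝔊.N) ℂ)ˣ) :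
        Matrix (Fin 𝔊.N) (Fin 𝔊.N) ℂ)) (regClass 𝔊 (regMin 𝔠) k h))
    (hT : letI := rhoTopology 𝔊; ∀ (S : Scales L) (k : ℕ) (h : Hist S.P k), ContinuousOn (T S k) (regClass 𝔊 (regMin 𝔠) k h))
    (hsolv : ∀ (S : Scales L) (k : ℕ), k ≤ S.K → ∀ (h : Hist S.P k),
      Hist.Admissible (regMin 𝔠).lane.carrier.M₁ (rcolOf S (regMin 𝔠).lane.carrier) k h →
      ∀ (V : GaugeField S.P k G), ∃ U ∈ admB42 𝔊 (regMin 𝔠) k h (Vl S k h) (Sm S k h) (T S k) (Bk S k h) V,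
        IsMinOn (A S) (admB42 𝔊 (regMin 𝔠) k h (Vl S k h) (Sm S k h) (T S k) (Bk S k h) V) U) :
    ∃ X : ∀ S : Scales L, ExternalInputs S G,
      (∀ S, (X S).av = (X₀ S).av ∧ (X S).reg = (X₀ S).reg) ∧ (∀ (S : Scales L) (k : ℕ) (h : Hist S.P k), Measurable ((X S).UkH k h)) ∧
      (∀ S, InEdgeFaces₃ 𝔊 (regMin 𝔠) (X S)) ∧
      (∀ (S : Scales L) (𝔖 : ∀ k, StepSeries S G ↥(lieC 𝔊) (nblkOf S 𝔠.lane.carrier k) k) (𝔄 : AlphaData 𝔊 𝔠 (X S) 𝔖)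
        (coef : (k : ℕ) → Hist S.P (k + 1) → GaugeField S.P (k + 1) G → (j : ℕ) → TermSizes (oldGeom S.P k j)),
        S.g ^ 2 * S.ε₀ ≤ (min (gammaN08 𝔠) 1) ^ 2 → RunDataRows 𝔊 𝔠 (X S) 𝔖 𝔄 (sizesOf 𝔊 𝔠 (X S) coef) → RunAlpha 𝔊 𝔠 (X S) 𝔖 𝔄) ∧
      ∀ (𝔖 : ∀ (S : Scales L) (k : ℕ), StepSeries S G ↥(lieC 𝔊) (nblkOf S 𝔠.lane.carrier k) k)
        (𝔄 : ∀ S : Scales L, AlphaData 𝔊 𝔠 (X S) (𝔖 S))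
        (coef : ∀ (S : Scales L) (k : ℕ), Hist S.P (k + 1) → GaugeField S.P (k + 1) G → (j : ℕ) → TermSizes (oldGeom S.P k j))
        (Xc : PrintedCarriersR) (Y : PrintedCarriers9X) (Z : PrintedCarriers11) (V : PrintedCarriers14R) (W : PrintedCarriers15)
        (w : WorldP) (P : B12.RunParams),
        (∀ S : Scales L, S.g ^ 2 * S.ε₀ ≤ (min (gammaN08 𝔠) 1) ^ 2 →
          RunDataRows 𝔊 𝔠 (X S) (𝔖 S) (𝔄 S) (sizesOf 𝔊 𝔠 (X S) (coef S))) →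
        w.up P = ofPrintedAllXPNC (Xc.withTowerRuns10 fun S : ScalesLE L ((min (gammaN08 𝔠) 1) ^ 2) =>
          towerOf 𝔠.lane (X S.1) (𝔖 S.1)) Y Z V W →
        Dag.B10_main (leavesP w P) := by
  have H : ∀ S : Scales L, ∃ X : ExternalInputs S G, X.av = (X₀ S).av ∧ X.reg = (X₀ S).reg ∧
      (∀ (k : ℕ) (h : Hist S.P k), Measurable (X.UkH k h)) ∧ InEdgeFaces₃ 𝔊 (regMin 𝔠) X ∧
      ∀ (𝔖 : ∀ k, StepSeries S G ↥(lieC 𝔊) (nblkOf S 𝔠.lane.carrier k) k) (𝔄 : AlphaData 𝔊 𝔠 X 𝔖)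
        (coef : (k : ℕ) → Hist S.P (k + 1) → GaugeField S.P (k + 1) G → (j : ℕ) → TermSizes (oldGeom S.P k j)),
        S.g ^ 2 * S.ε₀ ≤ (min (gammaN08 𝔠) 1) ^ 2 → RunDataRows 𝔊 𝔠 X 𝔖 𝔄 (sizesOf 𝔊 𝔠 X coef) → RunAlpha 𝔊 𝔠 X 𝔖 𝔄 :=
    fun S => exists_externalInputs_runAlpha 𝔊 𝔠 (X₀ S) (hA S) (Vl S) (hVl S) (Sm S) (hSm S) (T S) (Bk S) (hcont S) (hT S) (hsolv S)
  choose X hav hreg hm hF hα using H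
  refine ⟨X, fun S => ⟨hav S, hreg S⟩, hm, hF, hα, ?_⟩
  intro 𝔖 𝔄 coef Xc Y Z V W w P hD hup
  exact b10_main_constructedLE_upC_of_faces₃_family (X := X) (𝔖 := 𝔖) (𝔄 := 𝔄) (coef := coef) hD (fun S _ => hF S) hup

end Family

end Summit.QuantumFields.YangMills.Theorems.BalabanUVNodesN08AlphaSelEnd

end
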